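import Summits.QuantumAdvantage.AdviceFreeQNC0.AffBells25StrongRigidityLin
import Mathlib.Combinatorics.Pigeonhole
import HarnessLib

/-!
# Sketch25's remaining typed targets: `ClassToCube` (P-25a) and `FullCubeLemma` (P-25b), PROVED

Prover seat qn-prover-3 g14 (planner qn-p1 g25, ROUND-24 §2.2–§2.3; asks P-25a/b, optional after Theorem B′).  With this file
EVERY `def … : Prop` of `AffBells25FullSupportRigidity.lean` (= Sketch25) is a tree theorem.

* **`classToCube : AffBells25.ClassToCube`** — arbitrary supports: if `4·3^K < Z`, an XOR of `K` tests constant on a parity class is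
  constant on the whole cube.  PROOF (§2.3): the `Z` columns `(γ_g e)_g ∈ (ℤ/3)^K` take `≤ 3^K` values, so (pigeonhole,
  `Fintype.exists_lt_card_fiber_of_mul_lt_card`) some `≥ 5` coins carry the same column; any point `y` is constant on `3` of them,
  and flipping those three coins (`Fib19.flipAt`) changes every test's form `Σ γ_g` by `±3·v_g = 0` while switching the parity class
  (`Fib19.card_filter_flipAt_add_mod_two`); so every point has a partner in `P_σ` with the same XOR.
* **`fullCubeLemma : AffBells25.FullCubeLemma`** — full supports, `K < 2^{Z−1}`, XOR constant on the cube ⇒ balanced.  PROOF: by the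
  linearisation (L3) with `S = ∅`, `A_δ = (K+b)·ω^{⟨δ,1⟩}` for every sign `δ`; `β = 0` gives `A ≡ 0`, i.e. balanced
  (`coefA_self_ne_zero_of_unbalanced`); `β = 1` gives `A_δ ≠ 0` for all `2^Z` signs, against `#{A ≠ 0} ≤ 2K < 2^Z`.
* an `example` re-deriving Theorem B the planner's way (`strong_of_lemmas classToCube fullCubeLemma`).

WHAT THIS IS NOT: instrument for the (NP₀) rung of crux stmt-QuantumAdvantage-22907 (route DWalkThree); no route item;
separation NOT moved.
-/

namespace Summit.QuantumAdvantage.AdviceFreeQNC0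

namespace AffBells25L

open Finset AffBells24 AffBells25 Polynomial

/-! ### Three-coin flips on a constant column block -/

/-- In `ZMod 3`, three equal terms cancel. -/
theorem three_nsmul_zmod3 (d : ZMod 3) : 3 • d = 0 := by
  revert d; decide

/-- Flipping three coins on which `γ` is constant (`= v`) and `y` is constant (`= b₀`) does not change the test
`[Σ_{e : y e} γ_e = c]` (the form moves by `±3v = 0`). -/
theorem test_flipAt_three {Z : ℕ} (γ : Fin Z → ZMod 3) (c : ZMod 3) (T : Finset (Fin Z)) (hT : T.card = 3)
    (v : ZMod 3) (hγ : ∀ e ∈ T, γ e = v) (y : Fin Z → Bool) (b₀ : Bool) (hy : ∀ e ∈ T, y e = b₀) :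
    test γ c (Fib19.flipAt y T) = test γ c y := by
  classical
  have hform : (∑ e, if Fib19.flipAt y T e then γ e else 0) = ∑ e, if y e then γ e else 0 := by
    rw [← sub_eq_zero, ← sum_sub_distrib]
    have hterm : ∀ e, ((if Fib19.flipAt y T e then γ e else 0) - (if y e then γ e else 0)) =
        if e ∈ T then ((if (!b₀) then v else 0) - (if b₀ then v else 0)) else 0 := by
      intro e
      by_cases he : e ∈ T
      · rw [if_pos he, Fib19.flipAt_apply_of_mem he, hy e he, hγ e he]
      · rw [if_neg he, Fib19.flipAt_apply_of_not_mem he, sub_self]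
    rw [sum_congr rfl fun e _ => hterm e, ← sum_filter, filter_mem_eq_inter, univ_inter, sum_const, hT,
      three_nsmul_zmod3]
  unfold test
  rw [hform]

/-- Hence the XOR of a family is unchanged, if every row is constant on the three coins. -/
theorem xorTests_flipAt_three {Z K : ℕ} (γ : Fin K → Fin Z → ZMod 3) (c : Fin K → ZMod 3) (T : Finset (Fin Z))
    (hT : T.card = 3) (v : Fin K → ZMod 3) (hγ : ∀ g, ∀ e ∈ T, γ g e = v g) (y : Fin Z → Bool) (b₀ : Bool)
    (hy : ∀ e ∈ T, y e = b₀) :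
    xorTests γ c (Fib19.flipAt y T) = xorTests γ c y := by
  unfold xorTests
  have h : (univ.filter fun g => test (γ g) (c g) (Fib19.flipAt y T) = true) =
      univ.filter fun g => test (γ g) (c g) y = true := by
    refine filter_congr fun g _ => ?_
    rw [test_flipAt_three (γ g) (c g) T hT (v g) (hγ g) y b₀ hy]
  rw [h]

/-- Flipping three coins switches the parity class. -/
theorem flipAt_three_mem_parityClass {Z : ℕ} (σ : ℕ) (T : Finset (Fin Z)) (hT : T.card = 3) (y : Fin Z → Bool)
    (hy : y ∉ parityClass Z σ) : Fib19.flipAt y T ∈ parityClass Z σ := by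
  classical
  have h := Fib19.card_filter_flipAt_add_mod_two y univ T true
  rw [univ_inter, hT] at h
  unfold parityClass at hy ⊢
  rw [mem_filter] at hy ⊢
  simp only [mem_univ, true_and] at hy ⊢
  omega

/-! ### (P-25a) class-to-cube -/

/-- **`ClassToCube`** (ROUND-24 §2.3): for `4·3^K < Z`, an XOR of `K` tests constant on a parity class is constant on the cube. -/
theorem classToCube : ClassToCube := by
  classical
  intro Z K σ γ c hZ hconst
  -- pigeonhole on the columns
  obtain ⟨v, hv⟩ := Fintype.exists_lt_card_fiber_of_mul_lt_card (f := fun e : Fin Z => fun g : Fin K => γ g e)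
    (n := 4) (by rw [Fintype.card_fin, Fintype.card_fun, ZMod.card, Fintype.card_fin]; linarith)
  set F := (univ : Finset (Fin Z)).filter fun e => (fun g : Fin K => γ g e) = v with hF
  have hFv : ∀ g, ∀ e ∈ F, γ g e = v g := by
    intro g e he
    rw [hF, mem_filter] at he
    exact congrFun he.2 g
  -- every point has a partner in `P_σ` with the same XOR
  have key : ∀ y : Fin Z → Bool, ∃ y₁ ∈ parityClass Z σ, xorTests γ c y₁ = xorTests γ c y := by
    intro y
    by_cases hy : y ∈ parityClass Z σ
    · exact ⟨y, hy, rfl⟩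
    · -- three coins of `F` on which `y` is constant
      obtain ⟨b₀, hb₀⟩ : ∃ b₀ : Bool, 3 ≤ (F.filter fun e => y e = b₀).card := by
        have hsplit := card_filter_add_card_filter_not (s := F) (fun e => y e = true)
        by_cases h3 : 3 ≤ (F.filter fun e => y e = true).card
        · exact ⟨true, h3⟩
        · refine ⟨false, ?_⟩
          have e2 : (F.filter fun e => ¬ y e = true) = F.filter fun e => y e = false := by
            ext e; simp
          rw [e2] at hsplit
          omega
      obtain ⟨T, hTsub, hTcard⟩ := exists_subset_card_eq hb₀
      have hTy : ∀ e ∈ T, y e = b₀ := fun e he => (mem_filter.1 (hTsub he)).2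
      have hTF : ∀ g, ∀ e ∈ T, γ g e = v g := fun g e he => hFv g e (mem_filter.1 (hTsub he)).1
      exact ⟨Fib19.flipAt y T, flipAt_three_mem_parityClass σ T hTcard y hy,
        xorTests_flipAt_three γ c T hTcard v hTF y b₀ hTy⟩
  intro y y'
  obtain ⟨y₁, hy₁, e₁⟩ := key y
  obtain ⟨y₁', hy₁', e₁'⟩ := key y'
  rw [← e₁, ← e₁', hconst y₁ hy₁ y₁' hy₁']

/-! ### (P-25b) the full-cube lemma, from the linearisation -/

/-- **`FullCubeLemma`** (ROUND-24 §2.2): an XOR of `K < 2^{Z−1}` full-support tests constant on the whole cube is balanced. -/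
theorem fullCubeLemma : FullCubeLemma := by
  classical
  intro Z K γ c hfull hK hconst
  rcases Nat.eq_zero_or_pos K with hK0 | hKpos
  · subst hK0; intro g₀; exact Fin.elim0 g₀
  have hZpos : 0 < Z := by
    rcases Nat.eq_zero_or_pos Z with h | h
    · subst h; simp at hK; omega
    · exact h
  -- constant value `b` everywhere, in particular on `P_0`; the exceptional set is empty
  set b := xorTests γ c (fun _ => false) with hbdef
  have hb : ∀ y ∈ parityClass Z 0, xorTests γ c y = b := fun y _ => hconst y _
  have hS : excS γ c 0 b = ∅ := by
    unfold excS
    rw [filter_eq_empty_iff]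
    intro y _ h
    exact h (hconst y _)
  have hlin := linearisation Z K 0 γ c b hfull hb
  by_contra hbal
  unfold AffBells25.Balanced at hbal
  push Not at hbal
  obtain ⟨g₀, r, s, hrs⟩ := hbal
  have hA0 : coefA γ c (γ g₀) ≠ 0 := coefA_self_ne_zero_of_unbalanced γ c g₀ (self_ne_neg γ hfull hZpos g₀) hrs
  rcases beta_cases K b with hβ | hβ
  · -- β = 0: every coefficient vanishes
    apply hA0
    rw [hlin (γ g₀) (hfull g₀), hβ, zero_mul, zero_add, hS]
    unfold FS
    rw [sum_empty, mul_zero]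
  · -- β = 1: every one of the 2^Z sign vectors has a non-zero coefficient, but at most 2K < 2^Z do
    have hall : ((univ : Finset (Fin Z → Bool)).filter fun y => coefA γ c (signOf y) ≠ 0) = univ := by
      refine filter_true_of_mem fun y _ => ?_
      rw [hlin (signOf y) (isSign_signOf y), hβ, one_mul, hS]
      unfold FS
      rw [sum_empty, mul_zero, add_zero]
      exact ωpow_ne_zero _
    have hcard := card_filter_coefA_ne_zero_le γ c
    rw [hall, card_univ, Fintype.card_fun, Fintype.card_bool, Fintype.card_fin] at hcard
    have h2 : 2 ^ Z = 2 * 2 ^ (Z - 1) := by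
      rw [← pow_succ']; congr 1; omega
    omega

/-- Theorem B the planner's way: `strong_of_lemmas classToCube fullCubeLemma` re-proves `StrongFullSupportRigidity`
(already landed as `strongFullSupportRigidity`, obtained from B′; recorded here as an `example`). -/
example : StrongFullSupportRigidity :=
  strong_of_lemmas classToCube fullCubeLemma

end AffBells25L

end Summit.QuantumAdvantage.AdviceFreeQNC0
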